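import Summits.BirchSwinnertonDyer.Rank1Residual.Additive.X3BranchResidualQuotSelmerLayerCount
import Summits.BirchSwinnertonDyer.Rank1Residual.Additive.X3BranchLayerPrimesAbove
import HarnessLib

/-!
# X3 degenerate road, brick U5c: the LAYER-FREE class-level U-side count `3^{σ(S₀) − 1} ≤ #U(W[3]/Φ₀)`
# (cell `bsd-eis`, seat `bsd-eis-x3` gen 9; route K1 `AdditiveBranchIMC`, crux `GordTwoRankZeroOffCaseOne`
# — supports only; THEOREMS ONLY)

HONEST FRAMING (`run/shared/lean/pub/bsd-eis/README.md` §4): the programme's target of record is the full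
Birch–Swinnerton-Dyer formula for every `E/ℚ` of analytic rank `≤ 1`; this file closes the U-side half of
the CLASS-LEVEL count of `x3-MEMO-11.md` §2 for the DEGENERATE X3♯(G-ord) rows at `p = 3`:
  `3^{σ(S₀) − 1} ≤ #U(W[3]/Φ₀)`,  `σ(S₀) = Σ_{v ∈ S₀} s_{ℓ_v}`,  `s_ℓ = sFactor 3 ℓ`
(`X3Branch.pow_sum_sFactor_le_natCard_residualQuotSelmer_of_trivialLine`), for every cyclotomic `κ`, every
finite set `S₀` of places away from `3` and every rational `3`-line fixed pointwise — by the layer count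
(U5b) at the layer `N = Σ_v v₃(ℓ_v² − 1)`, where every `ℓ_v` already has its `s_{ℓ_v}` primes (U4), the
primes over distinct `ℓ_v` being distinct.  Nothing is booked here.
References: [GreenbergVatsal2000] §2 Prop. (2.4), pp. 26–30; [Washington1997] §13.1.
-/

set_option autoImplicit false

noncomputable section

open scoped Classical AddSubgroup NumberField

namespace Summit.BirchSwinnertonDyer.Rank1Residual.Additive

open NumberField IsDedekindDomain Field WeierstrassCurve Finset
  Literature.NumberTheory.GaloisRepresentations
  Literature.NumberTheory.EllipticCurves
  Literature.NumberTheory.EllipticCurves.GreenbergSelmer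
  Literature.NumberTheory.EllipticCurves.GreenbergVatsal2000
  Literature.NumberTheory.EllipticCurves.Rank1Residual
  Literature.NumberTheory.NumberFields
  Summit.BirchSwinnertonDyer.Rank1Residual.X2.ResidualDevissageModules
  Summit.BirchSwinnertonDyer.Rank1Residual.X2.ResidualDevissageLine

namespace KummerFamily

/-- **Primes over distinct rational primes are distinct**: for a finite set `S₀` of places of `ℚ` and a
number field `K`, `Σ_{v ∈ S₀} #{w ∣ ℓ_v} ≤ #{w ∣ ∏_v ℓ_v}` (in fact equality). [folklore] -/
theorem sum_natCard_primes_le_natCard_primes_prod (K : Type) [Field K] [NumberField K]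
    (S₀ : Finset (HeightOneSpectrum (𝓞 ℚ))) :
    ∑ v ∈ S₀, Nat.card {w : HeightOneSpectrum (𝓞 K) //
        (Rat.HeightOneSpectrum.natGenerator v : 𝓞 K) ∈ w.asIdeal} ≤
      Nat.card {w : HeightOneSpectrum (𝓞 K) //
        ((∏ v ∈ S₀, Rat.HeightOneSpectrum.natGenerator v : ℕ) : 𝓞 K) ∈ w.asIdeal} := by
  have hm₀ : (∏ v ∈ S₀, Rat.HeightOneSpectrum.natGenerator v : ℕ) ≠ 0 :=
    prod_ne_zero_iff.mpr fun v _ => (Rat.HeightOneSpectrum.prime_natGenerator v).ne_zero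
  haveI : Finite {w : HeightOneSpectrum (𝓞 K) //
      ((∏ v ∈ S₀, Rat.HeightOneSpectrum.natGenerator v : ℕ) : 𝓞 K) ∈ w.asIdeal} :=
    (finite_primes_natCast_mem (K := K) hm₀).to_subtype
  -- the map `(v, w) ↦ w`
  let f : (Σ v : S₀, {w : HeightOneSpectrum (𝓞 K) //
      (Rat.HeightOneSpectrum.natGenerator v.1 : 𝓞 K) ∈ w.asIdeal}) →
      {w : HeightOneSpectrum (𝓞 K) //
        ((∏ v ∈ S₀, Rat.HeightOneSpectrum.natGenerator v : ℕ) : 𝓞 K) ∈ w.asIdeal} :=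
    fun x => ⟨x.2.1, by
      obtain ⟨c, hc⟩ := dvd_prod_of_mem (fun v => Rat.HeightOneSpectrum.natGenerator v) x.1.2
      rw [hc, Nat.cast_mul]
      exact Ideal.mul_mem_right _ _ x.2.2⟩
  have hf : Function.Injective f := by
    rintro ⟨⟨v, hv⟩, ⟨w, hw⟩⟩ ⟨⟨v', hv'⟩, ⟨w', hw'⟩⟩ h
    have hww' : w = w' := congrArg Subtype.val h
    subst hww'
    have hvv' : v = v' := by
      by_contra hne
      have hne' : Rat.HeightOneSpectrum.natGenerator v ≠ Rat.HeightOneSpectrum.natGenerator v' :=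
        fun heq => hne (Rat.HeightOneSpectrum.primesEquiv.injective (Subtype.ext heq))
      have hcop : Nat.Coprime (Rat.HeightOneSpectrum.natGenerator v)
          (Rat.HeightOneSpectrum.natGenerator v') :=
        (Nat.coprime_primes (Rat.HeightOneSpectrum.prime_natGenerator v)
          (Rat.HeightOneSpectrum.prime_natGenerator v')).mpr hne'
      have h1 : (1 : 𝓞 K) ∈ w.asIdeal := by
        obtain ⟨a, b, hab⟩ := Nat.isCoprime_iff_coprime.mpr hcop
        have hab' : (a : 𝓞 K) * (Rat.HeightOneSpectrum.natGenerator v : 𝓞 K) +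
            (b : 𝓞 K) * (Rat.HeightOneSpectrum.natGenerator v' : 𝓞 K) = 1 := by
          exact_mod_cast hab
        rw [← hab']
        exact Ideal.add_mem _ (Ideal.mul_mem_left _ _ hw) (Ideal.mul_mem_left _ _ hw')
      exact w.isPrime.ne_top ((Ideal.eq_top_iff_one _).mpr h1)
    subst hvv'
    rfl
  have hle := Nat.card_le_card_of_injective f hf
  haveI : ∀ v : S₀, Finite {w : HeightOneSpectrum (𝓞 K) //
      (Rat.HeightOneSpectrum.natGenerator v.1 : 𝓞 K) ∈ w.asIdeal} := fun v =>
    (finite_primes_natCast_mem (K := K) (Rat.HeightOneSpectrum.prime_natGenerator v.1).ne_zero).to_subtype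
  rw [Nat.card_sigma] at hle
  rwa [← Finset.sum_coe_sort]

end KummerFamily

variable {W : WeierstrassCurve ℚ} [W.IsElliptic]

/-- **The LAYER-FREE class-level U-side count `3^{σ(S₀)−1} ≤ #U(W[3]/Φ₀)`**, `σ(S₀) = Σ_{v∈S₀} s_{ℓ_v}`,
`s_ℓ = sFactor 3 ℓ = 3^{v₃(ℓ²−1)−1}` (GV's number of primes of `ℚ_∞` above `ℓ`), for every cyclotomic `κ`,
every finite `S₀ ∌ (3)` and every rational `3`-line `Φ₀` fixed pointwise (assuming `U` finite): the layer
count U5b at `N = Σ_v v₃(ℓ_v² − 1)`, where each `ℓ_v` has `≥ s_{ℓ_v}` primes (U4), over distinct `ℓ_v`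
distinct.  [cite: GreenbergVatsal2000, §2 Prop. (2.4) and pp. 26–30] [cite: Washington1997, §13.1] -/
theorem X3Branch.pow_sum_sFactor_le_natCard_residualQuotSelmer_of_trivialLine
    [hp : Fact (Nat.Prime 3)] (κ : ZpExtension ℚ 3) (hκ : κ.IsCyclotomic)
    (S₀ : Finset (HeightOneSpectrum (𝓞 ℚ))) (hS₀ : ∀ v ∈ S₀, ((3 : ℕ) : 𝓞 ℚ) ∉ v.asIdeal)
    {Φ₀ : AddSubgroup (W.geomTorsion ((3 : ℕ) : ℤ))} (hΦ : IsRationalLine W 3 Φ₀)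
    (htriv : ∀ (σ : absoluteGaloisGroup ℚ) (Pt : geomTorsion W ((3 : ℕ) : ℤ)), Pt ∈ Φ₀ → σ • Pt = Pt)
    [Finite (residualQuotSelmer W 3 κ S₀ Φ₀ hΦ)] :
    3 ^ (∑ v ∈ S₀, sFactor 3 (Rat.HeightOneSpectrum.natGenerator v) - 1) ≤
      Nat.card (residualQuotSelmer W 3 κ S₀ Φ₀ hΦ) := by
  have natCast_mem_iff : ∀ (v : HeightOneSpectrum (𝓞 ℚ)) (n : ℕ),
      (n : 𝓞 ℚ) ∈ v.asIdeal ↔ Rat.HeightOneSpectrum.natGenerator v ∣ n := fun v n => by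
    rw [Rat.HeightOneSpectrum.natGenerator_dvd_iff,
      ← map_natCast (Rat.IsIntegralClosure.intEquiv (𝓞 ℚ)) n, Ideal.apply_mem_of_equiv_iff]
  -- the layer where every `ℓ_v` has all its primes
  set N : ℕ := ∑ v ∈ S₀, padicValNat 3 (Rat.HeightOneSpectrum.natGenerator v ^ (3 - 1) - 1) with hN
  haveI : FiniteDimensional ℚ (κ.layer N) := κ.finiteDimensional_layer_holds N
  haveI : NumberField (κ.layer N) := NumberField.of_module_finite ℚ (κ.layer N)
  have hlayer := X3Branch.pow_card_le_natCard_residualQuotSelmer_of_trivialLine_of_layer κ hκ S₀ hS₀ hΦ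
    htriv N
  refine le_trans (Nat.pow_le_pow_right (by norm_num) (Nat.sub_le_sub_right ?_ 1)) hlayer
  refine le_trans (sum_le_sum fun v hv => ?_)
    (KummerFamily.sum_natCard_primes_le_natCard_primes_prod (κ.layer N) S₀)
  haveI : Fact (Rat.HeightOneSpectrum.natGenerator v).Prime := ⟨Rat.HeightOneSpectrum.prime_natGenerator v⟩
  have hℓ3 : Rat.HeightOneSpectrum.natGenerator v ≠ 3 := fun h =>
    hS₀ v hv ((natCast_mem_iff v 3).mpr (h ▸ dvd_rfl))
  have hNv : padicValNat 3 (Rat.HeightOneSpectrum.natGenerator v ^ (3 - 1) - 1) ≤ N + 1 :=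
    le_trans (single_le_sum (f := fun v => padicValNat 3
      (Rat.HeightOneSpectrum.natGenerator v ^ (3 - 1) - 1)) (fun _ _ => Nat.zero_le _) hv)
      (Nat.le_succ _)
  exact hκ.pow_padicValNat_le_natCard_primes_layer (by decide) hℓ3 hNv

end Summit.BirchSwinnertonDyer.Rank1Residual.Additive

end
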